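import Summits.CriticalPhenomena.PercolationContinuityZ3.Theorems.Transplant.FKConnectivityAllQForestDetourTriangle
import Summits.CriticalPhenomena.PercolationContinuityZ3.Theorems.Transplant.FKConnectivityAllQForestTwoCellArrow
import HarnessLib

/-!
# The detour lemma settles the kvy = 2 class of the two-cell bound `TwoCellBoundOn` (every labelling, every fibre)

Support file (`--supports stmt-CriticalPhenomena-4575`), FK sub-lane `prim-bschramm-fk-1` (generation 31) of the post-continuity
programme; builds on p205010 (kernel theorem, internal audit signed; external expert review pending).  No definitions, no named facts,
no sorries; standard axioms.

`…ForestDetourTriangle` proves `TwoCellIneq M' u₀ o v y w v y v y` (apex `w`, dominating pair `vy`) from `DetourOn V` when `vy ∉ M' ∪ u₀`.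
THIS FILE removes the side condition (if `vy` is a free or pinned pair of the rest fibre the left side of the inequality vanishes:
**`twoCellIneq_vy_of_mem`**), records that `TwoCellIneq` depends on the triple and the pair only through the (symmetric) separation events
(**`sep₂Ev_comm`**, **`sep₃Ev_swap₁₂`**, **`sep₃Ev_swap₂₃`**, **`twoCellIneq_congr`**), and concludes
**`twoCellBound_kvy2_of_detour`**: under `DetourOn V`, for every rest fibre and every `(z; a, b, c)` exactly as quantified in
`TwoCellBoundOn V` with `{v, y} ⊆ {a, b, c}`, the disjunction of `TwoCellBoundOn` holds — the pair `vy` dominates.  So, of the three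
classes kvy = 2 / 1 / 0 of the open node H1′ = `TwoCellBoundPos` (the hypothesis of g30's kernel arrow
`adjForestRayleighNoSqPos_of_twoCellBoundPos`), the first is reduced to the detour lemma `DetourPos`; the classes kvy ≤ 1 remain: they are typed here as the node
**`TwoCellBoundFarOn V`** (H1′ restricted to triples NOT containing both ends; NOT asserted), with the assembly
**`twoCellBoundOn_of_detour_of_far : DetourOn V → TwoCellBoundFarOn V → TwoCellBoundOn V`** and, through g30's arrow,
**`adjForestRayleighNoSqPos_of_detourPos_of_farPos : DetourPos → TwoCellBoundFarPos → AdjForestRayleighNoSqPos`** — the node (♣)⁰ now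
rests on the detour lemma and the far two-cell bound (memo bschramm/FROM-fk-1-g31-DETOUR.md).
[cite: CibulkaHladkyLaCroixWagner2008, Case 3, Table 1 (p. 5)] [cite: SempleWelsh2008, Conj. 1.1 (p. 2); Thm. 4.2 (p. 11)]
[cite: Linusson2011, Prop. 2.6] [cite: Grimmett2006, §1.5 (p. 13)]
-/

noncomputable section

namespace Summit.CriticalPhenomena.PercolationContinuityZ3.Theorems
namespace FK

open Set Literature.Probability.LatticeModels Literature.Probability.Percolation
open scoped Classical symmDiff

variable {V : Type*} [Fintype V]

/-! ### Symmetries of the separation events -/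

section Symm

omit [Fintype V] in
/-- `sep₂Ev` is symmetric. [cite: Grimmett2006, §1.5 (p. 13)] -/
theorem sep₂Ev_comm (p q : V) : sep₂Ev p q = sep₂Ev q p := by
  ext ω
  simp only [sep₂Ev, mem_setOf_eq]
  exact ⟨fun h h' => h h'.symm, fun h h' => h h'.symm⟩

omit [Fintype V] in
/-- `sep₃Ev` is symmetric in its first two arguments. [cite: Grimmett2006, §1.5 (p. 13)] -/
theorem sep₃Ev_swap₁₂ (a b c : V) : sep₃Ev a b c = sep₃Ev b a c := by
  ext ω
  simp only [sep₃Ev, mem_setOf_eq]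
  exact ⟨fun ⟨h1, h2, h3⟩ => ⟨fun h' => h1 h'.symm, h3, h2⟩, fun ⟨h1, h2, h3⟩ => ⟨fun h' => h1 h'.symm, h3, h2⟩⟩

omit [Fintype V] in
/-- `sep₃Ev` is symmetric in its last two arguments. [cite: Grimmett2006, §1.5 (p. 13)] -/
theorem sep₃Ev_swap₂₃ (a b c : V) : sep₃Ev a b c = sep₃Ev a c b := by
  ext ω
  simp only [sep₃Ev, mem_setOf_eq]
  exact ⟨fun ⟨h1, h2, h3⟩ => ⟨h2, h1, fun h' => h3 h'.symm⟩, fun ⟨h1, h2, h3⟩ => ⟨h2, h1, fun h' => h3 h'.symm⟩⟩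

/-- `TwoCellIneq` depends on `(a, b, c)` and `(p, q)` only through `sep₃Ev a b c` and `sep₂Ev p q`. [cite: Linusson2011, Prop. 2.6] -/
theorem twoCellIneq_congr {M' u₀ : BondConfig V} {o v y a b c p q a' b' c' p' q' : V}
    (h3 : sep₃Ev a b c = sep₃Ev a' b' c') (h2 : sep₂Ev p q = sep₂Ev p' q') :
    TwoCellIneq M' u₀ o v y a b c p q ↔ TwoCellIneq M' u₀ o v y a' b' c' p' q' := by
  unfold TwoCellIneq
  rw [h3, h2]

end Symm

/-! ### The pair `vy` dominates -/

section KvyTwo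

variable {M' u₀ : BondConfig V} {o v y : V}

/-- If `vy` is already a pair of the rest fibre (free or pinned), the left side of `TwoCellIneq … w v y v y` vanishes: a first class through
`e, f` joins `v` to `y` and omits `vy`, so `vy` lies in the second class, which then does not separate `v` from `y`.
[cite: Grimmett2006, §1.5 (p. 13)] [cite: Linusson2011, Prop. 2.6] -/
theorem twoCellIneq_vy_of_mem (hov : o ≠ v) (hoy : o ≠ y) (hvy : v ≠ y)
    (ht : s(v, y) ∈ M' ∨ s(v, y) ∈ u₀) (w : V) : TwoCellIneq M' u₀ o v y w v y v y := by
  have hR : ∀ {ξ : BondConfig V}, s(o, v) ∈ ξ → s(o, y) ∈ ξ → (openGraph ξ).Reachable v y := fun he hf =>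
    ((openGraph_adj _ _ _).2 ⟨he, hov⟩).reachable.symm.trans ((openGraph_adj _ _ _).2 ⟨hf, hoy⟩).reachable
  -- in a bad colouring `vy` lies in the second class
  have htB : ∀ ω : BondConfig V, ω \ M' = u₀ → ω ∈ forestEv V → s(o, v) ∈ ω → s(o, y) ∈ ω →
      (openGraph (ω ∆ M')).Reachable v y := by
    intro ω hω hF he hf
    have htω : s(v, y) ∉ ω := not_mem_of_isForestCfg_of_two_mem hov hoy hvy hF he hf
    rcases ht with ht | ht
    · exact ((openGraph_adj _ _ _).2 ⟨Set.mem_symmDiff.2 (Or.inr ⟨ht, htω⟩), hvy⟩).reachable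
    · exact absurd (subset_of_fibre hω ht) htω
  unfold TwoCellIneq
  rw [fibreCount_eq_zero_of_forall _ _ _ _ fun ω _ hA _ => hA.1.2.2.2 (hR hA.2.1 hA.2.2),
    fibreCount_eq_zero_of_forall _ _ _ _ fun ω hω hA hB => hB.1.2.2.2 (htB ω hω hA.1 hA.2.1 hA.2.2),
    fibreCount_eq_zero_of_forall _ _ _ _ fun ω _ hA _ => hA.1.2 (hR hA.2.1 hA.2.2),
    fibreCount_eq_zero_of_forall _ _ _ _ fun ω hω hA hB => hB.1.2 (htB ω hω hA.1 hA.2.1 hA.2.2)]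
  exact Nat.zero_le _

/-- **`TwoCellIneq` for the pair `vy` at every apex `w`, every rest fibre**, from the detour lemma.
[cite: CibulkaHladkyLaCroixWagner2008, Case 3, Table 1 (p. 5)] [cite: SempleWelsh2008, Conj. 1.1 (p. 2)] [cite: Linusson2011, Prop. 2.6] -/
theorem twoCellIneq_vy_of_detour (hD : DetourOn V) (hd : Disjoint u₀ M') (hov : o ≠ v) (hoy : o ≠ y) (hvy : v ≠ y)
    (heM : s(o, v) ∈ M') (hfM : s(o, y) ∈ M') (w : V) : TwoCellIneq M' u₀ o v y w v y v y := by
  by_cases ht : s(v, y) ∈ M' ∨ s(v, y) ∈ u₀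
  · exact twoCellIneq_vy_of_mem hov hoy hvy ht w
  · rw [not_or] at ht
    exact twoCellIneq_of_detour hD hd hov hoy hvy heM hfM ht.1 ht.2 w

/-- **DL ⇒ the kvy = 2 class of H1′ = `TwoCellBoundOn`**: under `DetourOn V`, for every rest fibre `(M', u₀)` and every `(z; a, b, c)` as
quantified in `TwoCellBoundOn V` whose triple contains both ends `v, y`, one of the three two-cell inequalities holds (the one for the pair
`vy`). [cite: SempleWelsh2008, Conj. 1.1 (p. 2)] [cite: CibulkaHladkyLaCroixWagner2008, Case 3, Table 1 (p. 5)] [cite: Linusson2011, Prop. 2.6] -/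
theorem twoCellBound_kvy2_of_detour (hD : DetourOn V) (M' u₀ : BondConfig V) (o v y a b c : V) (hd : Disjoint u₀ M')
    (hvy : v ≠ y) (he : s(o, v) ∈ M') (hf : s(o, y) ∈ M') (hoa : o ≠ a) (hob : o ≠ b) (hoc : o ≠ c)
    (hv : a = v ∨ b = v ∨ c = v) (hy : a = y ∨ b = y ∨ c = y) :
    TwoCellIneq M' u₀ o v y a b c b c ∨ TwoCellIneq M' u₀ o v y a b c a c ∨ TwoCellIneq M' u₀ o v y a b c a b := by
  rcases hv with rfl | rfl | rfl <;> rcases hy with h | h | h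
  · exact absurd h hvy
  · -- triple (v, y, c): the pair is `ab`
    subst h
    exact Or.inr (Or.inr ((twoCellIneq_congr ((sep₃Ev_swap₂₃ _ _ _).trans (sep₃Ev_swap₁₂ _ _ _)) rfl).2
      (twoCellIneq_vy_of_detour hD hd hoa hob hvy he hf c)))
  · -- triple (v, b, y): the pair is `ac`
    subst h
    exact Or.inr (Or.inl ((twoCellIneq_congr (sep₃Ev_swap₁₂ _ _ _) rfl).2 (twoCellIneq_vy_of_detour hD hd hoa hoc hvy he hf b)))
  · -- triple (y, v, c): the pair is `ab = yv`
    subst h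
    exact Or.inr (Or.inr ((twoCellIneq_congr ((sep₃Ev_swap₁₂ _ _ _).trans ((sep₃Ev_swap₂₃ _ _ _).trans (sep₃Ev_swap₁₂ _ _ _)))
      (sep₂Ev_comm _ _)).2 (twoCellIneq_vy_of_detour hD hd hob hoa hvy he hf c)))
  · exact absurd h hvy
  · -- triple (a, v, y): the pair is `bc`
    subst h
    exact Or.inl (twoCellIneq_vy_of_detour hD hd hob hoc hvy he hf a)
  · -- triple (y, b, v): the pair is `ac = yv`
    subst h
    exact Or.inr (Or.inl ((twoCellIneq_congr ((sep₃Ev_swap₁₂ _ _ _).trans (sep₃Ev_swap₂₃ _ _ _)) (sep₂Ev_comm _ _)).2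
      (twoCellIneq_vy_of_detour hD hd hoc hoa hvy he hf b)))
  · -- triple (a, y, v): the pair is `bc = yv`
    subst h
    exact Or.inl ((twoCellIneq_congr (sep₃Ev_swap₂₃ _ _ _) (sep₂Ev_comm _ _)).2 (twoCellIneq_vy_of_detour hD hd hoc hob hvy he hf a))
  · exact absurd h hvy

end KvyTwo

/-! ### What is left of H1′: the classes kvy ≤ 1, and the assembly with g30's arrow -/

section Assembly

/-- **H1′ restricted to the classes kvy ≤ 1** (conjecture-shaped, NOT asserted): the disjunction of `TwoCellBoundOn` for every rest fibre and
every `(z; a, b, c)` exactly as quantified there, EXCEPT that the triple `{a,b,c}` does not contain both ends `v, y` (those triples are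
`twoCellBound_kvy2_of_detour`).  Evidence = that of `TwoCellBoundOn` (exhaustive n ≤ 10 all levels, n = 11 Laman, n ≤ 9 with pinned pairs;
memo bschramm/FROM-fk-1-g31-DETOUR.md §0.1); in every kvy = 1 cell of those censuses the dominating pair contains the end (the far apex
compensates). [cite: SempleWelsh2008, Conj. 1.1 (p. 2)] [cite: CibulkaHladkyLaCroixWagner2008, Case 3, Table 1 (p. 5)] [cite: Linusson2011, Prop. 2.6] -/
def TwoCellBoundFarOn (V : Type*) [Fintype V] : Prop :=
  ∀ (M' u₀ : BondConfig V) (o v y z a b c : V), Disjoint u₀ M' → v ≠ y → s(o, v) ∈ M' → s(o, y) ∈ M' →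
    (∀ g ∈ M' ∪ u₀, z ∉ g) → z ≠ o → z ≠ v → z ≠ y → z ≠ a → z ≠ b → z ≠ c → a ≠ b → a ≠ c → b ≠ c →
    o ≠ a → o ≠ b → o ≠ c → ¬ ((a = v ∨ b = v ∨ c = v) ∧ (a = y ∨ b = y ∨ c = y)) →
    TwoCellIneq M' u₀ o v y a b c b c ∨ TwoCellIneq M' u₀ o v y a b c a c ∨ TwoCellIneq M' u₀ o v y a b c a b

/-- **The far two-cell bound on every finite vertex type.**  CONJECTURE-SHAPED, NOT asserted. [cite: SempleWelsh2008, Conj. 1.1 (p. 2)] -/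
@[conjecture] def TwoCellBoundFarPos : Prop := ∀ n : ℕ, TwoCellBoundFarOn (Fin n)

/-- **Assembly**: the detour lemma and the far two-cell bound give the whole two-cell bound H1′ = `TwoCellBoundOn`.
[cite: SempleWelsh2008, Conj. 1.1 (p. 2)] [cite: Linusson2011, Prop. 2.6] -/
theorem twoCellBoundOn_of_detour_of_far (hD : DetourOn V) (hF : TwoCellBoundFarOn V) : TwoCellBoundOn V := by
  intro M' u₀ o v y z a b c hd hvy he hf hz hzo hzv hzy hza hzb hzc hab hac hbc hoa hob hoc
  by_cases h : (a = v ∨ b = v ∨ c = v) ∧ (a = y ∨ b = y ∨ c = y)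
  · exact twoCellBound_kvy2_of_detour hD M' u₀ o v y a b c hd hvy he hf hoa hob hoc h.1 h.2
  · exact hF M' u₀ o v y z a b c hd hvy he hf hz hzo hzv hzy hza hzb hzc hab hac hbc hoa hob hoc h

/-- **`DetourPos → TwoCellBoundFarPos → TwoCellBoundPos`.** [cite: SempleWelsh2008, Conj. 1.1 (p. 2)] -/
theorem twoCellBoundPos_of_detourPos_of_farPos (hD : DetourPos) (hF : TwoCellBoundFarPos) : TwoCellBoundPos :=
  fun n => twoCellBoundOn_of_detour_of_far (hD n) (hF n)

/-- **The node (♣)⁰ from the detour lemma and the far two-cell bound** (through g30's arrow `adjForestRayleighNoSqPos_of_twoCellBoundPos`):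
`DetourPos → TwoCellBoundFarPos → AdjForestRayleighNoSqPos`. [cite: SempleWelsh2008, Conj. 1.1 (p. 2); Thm. 4.2 (p. 11)]
[cite: CibulkaHladkyLaCroixWagner2008, Thm. 1 (p. 2)] [cite: Grimmett2006, §1.5 (p. 13)] -/
theorem adjForestRayleighNoSqPos_of_detourPos_of_farPos (hD : DetourPos) (hF : TwoCellBoundFarPos) : AdjForestRayleighNoSqPos :=
  adjForestRayleighNoSqPos_of_twoCellBoundPos (twoCellBoundPos_of_detourPos_of_farPos hD hF)

end Assembly

end FK
end Summit.CriticalPhenomena.PercolationContinuityZ3.Theorems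

end
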